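/-
Copyright: statement-level skeleton of a published paper (lit-balaban cell, Phase-2 proof seat p10, gen 4). No proof claims
beyond what the kernel checks below.
-/
import Mathlib
import Literature.MathematicalPhysics.QuantumFieldTheory.BalabanImbrieJaffe1984to88.BIJ85Eq7113DerivationPart3

/-!
# `BalabanImbrieJaffe1984to88.BIJ85Eq7113DerivationPart5` — T. Bałaban, J. Imbrie, A. Jaffe, *Renormalization of the Higgs model:
minimizers, propagators and the stability of mean field theory*, Commun. Math. Phys. **97** (1985) 299–329
[BalabanImbrieJaffe1985]: Prop. 7.1.2 (7.1.22) p. 324 *"for all |p_j| ≤ π"* — **Theorem 7.1.1 for the fibre energies of (4.2.1) at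
EVERY momentum of the closed cube, components zero or not**: c(d)‖f‖² ≤ ‖∂A − Q^{e*}_kf‖² for every two-form f and every A with
Q_kA = 0, the weights being the DIVISION-FREE (continuous) block-average symbols (file 5 of the derivation (7.1.12) ⟹ (7.1.13))

statement-level skeleton of published theorems with citation tags; proofs where landed; nothing here is a claim about
the Yang–Mills mass gap

CITATION HEADER (lean-in-tree rule).  Part of the lit-balaban TYPED SKELETON (HOME `run/shared/lean/pub/lit-balaban/`); WHAT IS
REPRODUCED: the remaining fibres of SKELETON rows **C1.Thm7.1.1** / **C1.Prop7.1.2** of `HOME/lit-balaban-r15/ROWS-C1.md` (fold owner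
r15, referee ref-5) for the ENERGY form of the fibre problem: files 1/3–3/3 (`BIJ85Eq7113Derivation`, `…Part2`, `…Part3`) derive
(7.1.13) and the bound `thm711_energy` at the GENERIC fibres (all 0 < |p′_μ| ≤ π), where r15's raw quotient v_μ = ∂^{(1)}_μ/∂_μ is
the block-average symbol; at momenta with a vanishing component that quotient is the junk value 0/0 (GAPS G-C1-03), so the printed
quantifier *"for all |p_j| ≤ π"* of (7.1.22) — needed fibre by fibre on a finite torus (p27's `BIJ85Eq712Plancherel.fibrewise_of_form_re_ge`)
— requires the weights with their removable singularities filled.  Kind «boundary completion by continuity», as this seat's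
`BIJ85Thm711ClosedCube` did for the symbols.
THE CLOSED-CUBE DATA (§1; η = 1/n, shifts l = 2πm, m ∈ `lShifts d M`): bond weight `rC` = u·v_ν with this seat's trigonometric-
polynomial symbols `uC`, `vC` ([6I] (1.61)); edge weight `wC` = z_μ^{n−1}z_ν^{n−1}·Π_{ρ∉{μ,ν}}v_ρ, z_ρ = e^{iηq_ρ} (`zC`) — DIVISION-
FREE, the phase being the one p27 g5 derived from configuration space for the concrete Q^e_k (`BIJ85Eq7111EdgeAverage.edgeW_eq`:
the edge plaquettes sit in the last fine layer of the block; `edgeW_mul_conj_vSym`: = u/(v̄_μv̄_ν) off the zeros of v); `qeStarC`,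
`qOpC`, `energyC A f = ‖∂A − Q^{e*}_kf‖²` (pairing (2.20) of file 1/3), the diagonal Gram entries `dDiag` = (Q_kQ_k^*)_{νν} = Σ_l|r_ν|²
and the constraint projection `proj A = A − Q_k^*(Q_kQ_k^*)^{−1}Q_kA`, the regular set `regC` ((Q_kQ_k^*)_{νν} ≠ 0).
WHAT IS PROVED (zero `sorry`, standard axioms).  §2 AGREEMENT at generic fibres: z^{n−1}v̄ = v for |z| = 1 (`zC_pow_mul_conj_vC`,
every q), hence `wC_eq_wE` (μ ≠ ν), `rC_eq_rQ`, `qOpC_eq_qOp`, `energyC_eq_energy` (two-forms) and the generic bound in the closed-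
cube data (`thm711_energyC_generic`, = file 3/3 `thm711_energy`).  §3 (Q_kQ_k^*)_{νν} > 0 on the whole closed cube (`dDiag_pos`, the
l = 0 term, `vC_ne_zero`); Q_k(proj A) = 0 (`qOpC_proj`); proj A = A when Q_kA = 0 (`proj_of_constrained`); the energy of the projected
field is continuous in p on the regular set (`continuousOn_energyC_proj`).  §4 **`thm711_energyC`: for every scale (n, M, 2M + 1 ≤ n),
every p with all |p_j| ≤ π, every two-form f and every A with Q_kA = 0: c(d)‖f‖² ≤ ‖∂A − Q^{e*}_kf‖²** (c(d) = `c711 d` of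
`BIJ85SigmaClosedCube`) — by projecting A onto the constraint spaces of the generic momenta `fillPath p t`, t ∈ (0, π], applying the
generic bound and letting t → 0.
NOT CLAIMED: the identification of the closed-cube minimum with ⟨f, σ^C_k(p)f⟩ of `BIJ85SigmaClosedCube` at the non-generic fibres
(only the inequality is transported); the configuration-space dictionary (p27).  Unit `lit-balaban-p10` (gen 4), HOME as above.
-/

namespace Literature.MathematicalPhysics.QuantumFieldTheory.BalabanImbrieJaffe1984to88.BIJ85Eq7113DerivationPart5

open scoped BigOperators Real ComplexConjugate Topology
open Complex Finset Filter
open Literature.MathematicalPhysics.QuantumFieldTheory.BalabanImbrieJaffe1984to88.BIJ85MomentumSymbols71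
open Literature.MathematicalPhysics.QuantumFieldTheory.BalabanImbrieJaffe1984to88.BIJ85CurlComplement719
open Literature.MathematicalPhysics.QuantumFieldTheory.BalabanImbrieJaffe1984to88.BIJ85Thm711Fibrewise
open Literature.MathematicalPhysics.QuantumFieldTheory.BalabanImbrieJaffe1984to88.BIJ85SigmaClosedCube
open Literature.MathematicalPhysics.QuantumFieldTheory.BalabanImbrieJaffe1984to88.BIJ85AveragingSums716
open Literature.MathematicalPhysics.QuantumFieldTheory.BalabanImbrieJaffe1984to88.BIJ85Eq7113Derivation
open Literature.MathematicalPhysics.QuantumFieldTheory.BalabanImbrieJaffe1984to88.BIJ85Eq7113DerivationPart2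
open Literature.MathematicalPhysics.QuantumFieldTheory.BalabanImbrieJaffe1984to88.BIJ85Eq7113DerivationPart3

noncomputable section

variable {d : ℕ}

/-! ## §1 The fibre data on the CLOSED cube: division-free weights -/

section Defs

variable (n M : ℕ) (p : Fin d → ℝ)

/-- bond weight, closed cube: r_ν(p′+l) = u(p′+l)v_ν(p′+l) with the block-average symbols `uC`, `vC` (removable singularities
filled). [cite: BalabanImbrieJaffe1985, (7.1.7) p.322] -/
def rC (m : Fin d → ℤ) (ν : Fin d) : ℂ := uC n (shiftMom p m) * vC n (shiftMom p m) ν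

/-- edge weight, closed cube, DIVISION-FREE: w_{μν}(q) = z_μ(q)^{n−1} z_ν(q)^{n−1} Π_{ρ∉{μ,ν}} v_ρ(q), z_ρ(q) = e^{iηq_ρ} — the
configuration-space phase of the edge plaquette (last fine layer) found by p27 (`BIJ85Eq7111EdgeAverage.edgeW_eq`); equal to
u/(v̄_μv̄_ν) off the zeros of v (`wC_eq_wE`). [cite: BalabanImbrieJaffe1985, (7.1.11) p.322] -/
def wC (m : Fin d → ℤ) (μ ν : Fin d) : ℂ :=
  zC n (shiftMom p m) μ ^ (n - 1) * zC n (shiftMom p m) ν ^ (n - 1) * qeW n (shiftMom p m) μ ν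

/-- Q^{e*}_kf at the shift l, closed cube. [cite: BalabanImbrieJaffe1985, (7.1.11) p.322] -/
def qeStarC (f : Fin d → Fin d → ℂ) (m : Fin d → ℤ) (μ ν : Fin d) : ℂ := conj (wC n p m μ ν) * f μ ν

/-- (Q_kA)_ν at the fibre, closed cube. [cite: BalabanImbrieJaffe1985, (4.2.1) p.310] -/
def qOpC (A : (Fin d → ℤ) → Fin d → ℂ) (ν : Fin d) : ℂ := ∑ m ∈ lShifts d M, rC n p m ν * A m ν

/-- ‖∂A − Q^{e*}_kf‖² at the fibre, closed cube (η = 1/n). [cite: BalabanImbrieJaffe1985, (4.2.1) p.310] -/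
def energyC (A : (Fin d → ℤ) → Fin d → ℂ) (f : Fin d → Fin d → ℂ) : ℝ :=
  pNormSq M fun m μ ν => curlF ((n : ℝ)⁻¹) p A m μ ν - qeStarC n p f m μ ν

/-- (Q_kQ_k^*)_{νν} = Σ_l |r_ν(p′+l)|² (diagonal; > 0 on the closed cube). [cite: BalabanImbrieJaffe1985, (4.2.1) p.310] -/
def dDiag (ν : Fin d) : ℝ := ∑ m ∈ lShifts d M, ‖rC n p m ν‖ ^ 2

/-- The projection A ↦ A − Q_k^*(Q_kQ_k^*)^{−1}Q_kA onto the constraint space {Q_kA = 0}. [cite: BalabanImbrieJaffe1985, (4.2.1) p.310] -/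
def proj (A : (Fin d → ℤ) → Fin d → ℂ) : (Fin d → ℤ) → Fin d → ℂ := fun m ν =>
  A m ν - conj (rC n p m ν) * qOpC n M p A ν / ((dDiag n M p ν : ℝ) : ℂ)

end Defs

/-! ## §2 Agreement with the generic-fibre data of file 1/3 -/

section Agreement

variable {n M : ℕ} {p : Fin d → ℝ}

/-- kernel: |z_μ(q)| = 1, so z̄ = z⁻¹. [folklore] -/
private theorem zC_mul_conj (n : ℕ) (q : Fin d → ℝ) (μ : Fin d) : zC n q μ * conj (zC n q μ) = 1 := by
  rw [Complex.mul_conj, Complex.normSq_eq_norm_sq, zC, Complex.norm_exp_I_mul_ofReal]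
  simp

/-- **z^{n−1}·v̄ = v** for the block-average symbol v = n^{−1}Σ_{j<n}z^j and |z| = 1 (every q; p27's `om_pow_mul_conj_vSym` in the
`vC` language). [cite: BalabanImbrieJaffe1985, (7.1.7) p.322] -/
theorem zC_pow_mul_conj_vC {n : ℕ} (hn : 0 < n) (q : Fin d → ℝ) (μ : Fin d) :
    zC n q μ ^ (n - 1) * conj (vC n q μ) = vC n q μ := by
  have hz : zC n q μ ≠ 0 := by rw [zC]; exact Complex.exp_ne_zero _
  have hzc : conj (zC n q μ) = (zC n q μ)⁻¹ :=
    (mul_eq_one_iff_eq_inv₀ hz).mp (by rw [mul_comm]; exact zC_mul_conj n q μ)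
  unfold vC
  rw [map_mul, map_inv₀, Complex.conj_natCast, map_sum, mul_left_comm]
  congr 1
  rw [Finset.mul_sum, ← Finset.sum_range_reflect]
  refine Finset.sum_congr rfl fun j hj => ?_
  have hj' : j < n := Finset.mem_range.mp hj
  rw [map_pow, hzc, inv_pow, ← div_eq_mul_inv, div_eq_iff (pow_ne_zero _ hz), ← pow_add]
  congr 1
  omega

/-- At a generic fibre the closed-cube edge weight is file 1/3's u/(v̄_μv̄_ν) (μ ≠ ν). [cite: BalabanImbrieJaffe1985, (7.1.11) p.322] -/
theorem wC_eq_wE (hn : 0 < n) (hp : ∀ i, p i ≠ 0 ∧ |p i| ≤ π) (m : Fin d → ℤ) {μ ν : Fin d} (hμν : μ ≠ ν) :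
    wC n p m μ ν = wE ((n : ℝ)⁻¹) p m μ ν := by
  have hv : ∀ ρ, vC n (shiftMom p m) ρ ≠ 0 := fun ρ => by
    rw [vC_shift_eq_vSym hn hp m ρ, vSym_eq]
    exact div_ne_zero (by rw [dOne_shiftMom]; exact fun h => (hp ρ).1 ((dOne_eq_zero_iff_of_abs_le (hp ρ).2).mp h))
      (generic_shift hn hp m ρ).2.1
  have hvc : ∀ ρ, conj (vC n (shiftMom p m) ρ) ≠ 0 := fun ρ => (map_ne_zero _).mpr (hv ρ)
  have hμ := zC_pow_mul_conj_vC hn (shiftMom p m) μ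
  have hν := zC_pow_mul_conj_vC hn (shiftMom p m) ν
  unfold wC wE
  rw [← uC_shift_eq_uSym hn hp m, ← vC_shift_eq_vSym hn hp m μ, ← vC_shift_eq_vSym hn hp m ν, uC, qeW,
    ← Finset.mul_prod_erase Finset.univ _ (Finset.mem_univ μ),
    ← Finset.mul_prod_erase _ _ (Finset.mem_erase.mpr ⟨hμν.symm, Finset.mem_univ ν⟩)]
  rw [eq_div_iff (mul_ne_zero (hvc μ) (hvc ν))]
  linear_combination ((∏ x ∈ (Finset.univ.erase μ).erase ν, vC n (shiftMom p m) x) *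
    zC n (shiftMom p m) ν ^ (n - 1) * conj (vC n (shiftMom p m) ν)) * hμ +
    ((∏ x ∈ (Finset.univ.erase μ).erase ν, vC n (shiftMom p m) x) * vC n (shiftMom p m) μ) * hν

/-- At a generic fibre the closed-cube bond weight is file 1/3's. [cite: BalabanImbrieJaffe1985, (7.1.7) p.322] -/
theorem rC_eq_rQ (hn : 0 < n) (hp : ∀ i, p i ≠ 0 ∧ |p i| ≤ π) (m : Fin d → ℤ) (ν : Fin d) :
    rC n p m ν = rQ ((n : ℝ)⁻¹) p m ν := by
  rw [rC, rQ, uC_shift_eq_uSym hn hp m, vC_shift_eq_vSym hn hp m ν]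

/-- Hence the constraint maps agree at generic fibres. [cite: BalabanImbrieJaffe1985, (4.2.1) p.310] -/
theorem qOpC_eq_qOp (hn : 0 < n) (hp : ∀ i, p i ≠ 0 ∧ |p i| ≤ π) (A : (Fin d → ℤ) → Fin d → ℂ) (ν : Fin d) :
    qOpC n M p A ν = qOp ((n : ℝ)⁻¹) M p A ν := by
  unfold qOpC qOp
  exact Finset.sum_congr rfl fun m _ => by rw [rC_eq_rQ hn hp]

/-- … and so do the energies of two-forms. [cite: BalabanImbrieJaffe1985, (4.2.1) p.310] -/
theorem energyC_eq_energy (hn : 0 < n) (hp : ∀ i, p i ≠ 0 ∧ |p i| ≤ π) (A : (Fin d → ℤ) → Fin d → ℂ)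
    {f : Fin d → Fin d → ℂ} (hf : IsTwoForm f) : energyC n M p A f = energy ((n : ℝ)⁻¹) M p A f := by
  unfold energyC energy pNormSq
  congr 1
  refine Finset.sum_congr rfl fun m _ => Finset.sum_congr rfl fun μ _ => Finset.sum_congr rfl fun ν _ => ?_
  by_cases hμν : μ = ν
  · subst hμν
    have h0 : f μ μ = 0 := by
      have := hf μ μ
      linear_combination (1 / 2 : ℂ) * this
    simp [qeStarC, qeStar, h0]
  · beta_reduce
    rw [qeStarC, qeStar, wC_eq_wE hn hp m hμν]

/-- The generic-fibre bound of file 3/3 in the closed-cube data. [cite: BalabanImbrieJaffe1985, (7.1.22) p.324] -/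
theorem thm711_energyC_generic (hd : 0 < d) (s : Scale) {p : Fin d → ℝ} (hp : ∀ i, p i ≠ 0 ∧ |p i| ≤ π)
    {f : Fin d → Fin d → ℂ} (hf : IsTwoForm f) {A : (Fin d → ℤ) → Fin d → ℂ} (hA : ∀ ν, qOpC s.n s.M p A ν = 0) :
    c711 d * normSq f ≤ energyC s.n s.M p A f := by
  have hn : 0 < s.n := s.pos.1
  rw [energyC_eq_energy hn hp A hf]
  exact thm711_energy hd s hp hf fun ν => by
    show qOp ((s.n : ℝ)⁻¹) s.M p A ν = 0
    rw [← qOpC_eq_qOp hn hp]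
    exact hA ν

end Agreement

/-! ## §3 The constraint projection and its continuity -/

section Projection

variable {n M : ℕ} {p : Fin d → ℝ}

/-- On the closed cube (Q_kQ_k^*)_{νν} > 0: the l = 0 term |u(p)v_ν(p)|² is positive. [cite: BalabanImbrieJaffe1985, (4.2.1) p.310] -/
theorem dDiag_pos (hn : 0 < n) (M : ℕ) (hp : ∀ i, |p i| ≤ π) (ν : Fin d) : 0 < dDiag n M p ν := by
  unfold dDiag
  have h0 : 0 < ‖rC n p 0 ν‖ ^ 2 := by
    rw [rC, shiftMom_zero, norm_mul]
    have hu : uC n p ≠ 0 := by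
      rw [uC]; exact Finset.prod_ne_zero_iff.mpr fun ρ _ => vC_ne_zero hn (hp ρ)
    have hv : vC n p ν ≠ 0 := vC_ne_zero hn (hp ν)
    positivity
  exact lt_of_lt_of_le h0 (Finset.single_le_sum (f := fun m => ‖rC n p m ν‖ ^ 2) (fun m _ => sq_nonneg _)
    (zero_mem_lShifts d M))

/-- The projected field is constrained: Q_k(A − Q_k^*(Q_kQ_k^*)^{−1}Q_kA) = 0. [cite: BalabanImbrieJaffe1985, (4.2.1) p.310] -/
theorem qOpC_proj (hD : ∀ ν, dDiag n M p ν ≠ 0) (A : (Fin d → ℤ) → Fin d → ℂ) (ν : Fin d) :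
    qOpC n M p (proj n M p A) ν = 0 := by
  have hDc : ((dDiag n M p ν : ℝ) : ℂ) ≠ 0 := Complex.ofReal_ne_zero.mpr (hD ν)
  have hsum : ∑ m ∈ lShifts d M, rC n p m ν * conj (rC n p m ν) = ((dDiag n M p ν : ℝ) : ℂ) := by
    rw [dDiag, Complex.ofReal_sum]
    exact Finset.sum_congr rfl fun m _ => by rw [Complex.mul_conj, Complex.normSq_eq_norm_sq]
  unfold proj
  unfold qOpC
  simp only [mul_sub, Finset.sum_sub_distrib]
  rw [show (∑ m ∈ lShifts d M, rC n p m ν * (conj (rC n p m ν) * (∑ m ∈ lShifts d M, rC n p m ν * A m ν) /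
      ((dDiag n M p ν : ℝ) : ℂ))) = (∑ m ∈ lShifts d M, rC n p m ν * conj (rC n p m ν)) *
      (∑ m ∈ lShifts d M, rC n p m ν * A m ν) / ((dDiag n M p ν : ℝ) : ℂ) from by
    rw [Finset.sum_mul, Finset.sum_div]
    exact Finset.sum_congr rfl fun m _ => by ring, hsum]
  field_simp
  ring

/-- A constrained field is its own projection. [cite: BalabanImbrieJaffe1985, (4.2.1) p.310] -/
theorem proj_of_constrained {A : (Fin d → ℤ) → Fin d → ℂ} (hA : ∀ ν, qOpC n M p A ν = 0) : proj n M p A = A := by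
  funext m ν
  rw [proj, hA ν, mul_zero, zero_div, sub_zero]

/-- kernel: p ↦ p + l is continuous. [folklore] -/
private theorem continuous_shiftMom (m : Fin d → ℤ) : Continuous fun p : Fin d → ℝ => shiftMom p m := by
  have : (fun p : Fin d → ℝ => shiftMom p m) = fun p => p + fun i => 2 * π * (m i : ℝ) := by
    funext p i; simp [shiftMom]
  rw [this]
  exact continuous_id.add continuous_const

/-- kernel: ∂_μ(q) is continuous in q. [folklore] -/
private theorem continuous_dSym (η : ℝ) (μ : Fin d) : Continuous fun q : Fin d → ℝ => dSym η q μ := by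
  unfold dSym
  refine Continuous.div_const ?_ _
  refine (Complex.continuous_exp.comp ?_).sub continuous_const
  exact continuous_const.mul (Complex.continuous_ofReal.comp (continuous_const.mul (continuous_apply μ)))

/-- kernel: z_μ(q) is continuous in q. [folklore] -/
private theorem continuous_zC (n : ℕ) (μ : Fin d) : Continuous fun q : Fin d → ℝ => zC n q μ := by
  unfold zC
  exact Complex.continuous_exp.comp
    (continuous_const.mul (Complex.continuous_ofReal.comp (continuous_const.mul (continuous_apply μ))))

/-- kernel: the closed-cube bond weight is continuous in p. [folklore] -/
private theorem continuous_rC (n : ℕ) (m : Fin d → ℤ) (ν : Fin d) : Continuous fun p : Fin d → ℝ => rC n p m ν := by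
  unfold rC uC
  exact (continuous_finsetProd _ fun ρ _ => (continuous_vC n ρ).comp (continuous_shiftMom m)).mul
    ((continuous_vC n ν).comp (continuous_shiftMom m))

/-- kernel: the closed-cube edge weight is continuous in p. [folklore] -/
private theorem continuous_wC (n : ℕ) (m : Fin d → ℤ) (μ ν : Fin d) : Continuous fun p : Fin d → ℝ => wC n p m μ ν := by
  unfold wC qeW
  exact ((((continuous_zC n μ).comp (continuous_shiftMom m)).pow _).mul
    (((continuous_zC n ν).comp (continuous_shiftMom m)).pow _)).mul
    (continuous_finsetProd _ fun ρ _ => (continuous_vC n ρ).comp (continuous_shiftMom m))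

/-- kernel: Q_kA is continuous in p. [folklore] -/
private theorem continuous_qOpC (n M : ℕ) (A : (Fin d → ℤ) → Fin d → ℂ) (ν : Fin d) :
    Continuous fun p : Fin d → ℝ => qOpC n M p A ν := by
  unfold qOpC
  exact continuous_finsetSum _ fun m _ => (continuous_rC n m ν).mul continuous_const

/-- kernel: (Q_kQ_k^*)_{νν} is continuous in p. [folklore] -/
private theorem continuous_dDiag (n M : ℕ) (ν : Fin d) : Continuous fun p : Fin d → ℝ => dDiag n M p ν := by
  unfold dDiag
  exact continuous_finsetSum _ fun m _ => ((continuous_rC n m ν).norm).pow 2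

/-- The regular set of the closed-cube data: (Q_kQ_k^*)_{νν} ≠ 0 for every ν (contains the whole closed cube, `dDiag_pos`).
[cite: BalabanImbrieJaffe1985, (4.2.1) p.310] -/
def regC (n M : ℕ) : Set (Fin d → ℝ) := {p | ∀ ν, dDiag n M p ν ≠ 0}

/-- kernel: the projected field is continuous in p on the regular set. [folklore] -/
private theorem continuousOn_proj (n M : ℕ) (A : (Fin d → ℤ) → Fin d → ℂ) (m : Fin d → ℤ) (ν : Fin d) :
    ContinuousOn (fun p : Fin d → ℝ => proj n M p A m ν) (regC (d := d) n M) := by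
  unfold proj
  refine continuousOn_const.sub (ContinuousOn.div ?_ ?_ fun p hp => Complex.ofReal_ne_zero.mpr (hp ν))
  · exact ((Complex.continuous_conj.comp (continuous_rC n m ν)).mul (continuous_qOpC n M A ν)).continuousOn
  · exact (Complex.continuous_ofReal.comp (continuous_dDiag n M ν)).continuousOn

/-- **The energy of the projected field is continuous in p on the regular set** (hence on the closed cube).
[cite: BalabanImbrieJaffe1985, (4.2.1) p.310] -/
theorem continuousOn_energyC_proj (n M : ℕ) (A : (Fin d → ℤ) → Fin d → ℂ) (f : Fin d → Fin d → ℂ) :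
    ContinuousOn (fun p : Fin d → ℝ => energyC n M p (proj n M p A) f) (regC (d := d) n M) := by
  unfold energyC pNormSq
  refine continuousOn_const.mul (continuousOn_finsetSum _ fun m _ => continuousOn_finsetSum _ fun μ _ =>
    continuousOn_finsetSum _ fun ν _ => ?_)
  refine (ContinuousOn.norm ?_).pow _
  refine ContinuousOn.sub ?_ ?_
  · unfold curlF
    exact (((continuous_dSym _ μ).comp (continuous_shiftMom m)).continuousOn.mul (continuousOn_proj n M A m ν)).sub
      (((continuous_dSym _ ν).comp (continuous_shiftMom m)).continuousOn.mul (continuousOn_proj n M A m μ))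
  · unfold qeStarC
    exact ((Complex.continuous_conj.comp (continuous_wC n m μ ν)).mul continuous_const).continuousOn

end Projection

/-! ## §4 Theorem 7.1.1 for the energies at EVERY momentum of the closed cube -/

/-- kernel: the path is continuous in t. [folklore] -/
private theorem continuous_fillPath (p : Fin d → ℝ) : Continuous (fillPath p) :=
  continuous_pi fun i => by
    by_cases h : p i = 0
    · simp only [fillPath, h, if_true]; exact continuous_id
    · simp only [fillPath, h, if_false]; exact continuous_const

/-- kernel: the path at t = 0 is p. [folklore] -/
private theorem fillPath_zero (p : Fin d → ℝ) : fillPath p 0 = p := by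
  funext i
  by_cases h : p i = 0 <;> simp [fillPath, h]

/-- kernel: the path stays in the closed cube for t ∈ [0, π]. [folklore] -/
private theorem fillPath_abs_le {p : Fin d → ℝ} (hp : ∀ i, |p i| ≤ π) {t : ℝ} (ht0 : 0 ≤ t) (htπ : t ≤ π) (i : Fin d) :
    |fillPath p t i| ≤ π := by
  by_cases h : p i = 0
  · simp only [fillPath, h, if_true]; rw [abs_of_nonneg ht0]; exact htπ
  · simp only [fillPath, h, if_false]; exact hp i

/-- kernel: the path is generic for t ∈ (0, π]. [folklore] -/
private theorem fillPath_generic {p : Fin d → ℝ} (hp : ∀ i, |p i| ≤ π) {t : ℝ} (ht0 : 0 < t) (htπ : t ≤ π) (i : Fin d) :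
    fillPath p t i ≠ 0 ∧ |fillPath p t i| ≤ π := by
  refine ⟨?_, fillPath_abs_le hp ht0.le htπ i⟩
  by_cases h : p i = 0
  · simp only [fillPath, h, if_true]; exact ht0.ne'
  · simp only [fillPath, h, if_false]; exact h

/-- **Theorem 7.1.1 for the fibre energies at EVERY momentum of the closed cube |p_j| ≤ π** (components may vanish, p = 0
included): for every two-form f and every A with Q_kA = 0 (closed-cube data: bond weight u·v_ν, division-free edge weight
z_μ^{n−1}z_ν^{n−1}Π_{ρ∉{μ,ν}}v_ρ), c(d)‖f‖² ≤ ‖∂A − Q^{e*}_kf‖².  Proof: at generic p this is file 3/3's `thm711_energy`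
(`thm711_energyC_generic`); in general, project A onto the constraint space of the generic momenta `fillPath p t`, t ∈ (0, π]
(`proj`, `qOpC_proj`), use the bound there, and let t → 0: the projected energy is continuous in t (`continuousOn_energyC_proj`,
`dDiag_pos`) and the projection is A itself at t = 0 (`proj_of_constrained`).  With p27's dictionary (configuration-space
Q_k, Q^e_k ↦ these weights) this is the hypothesis `hfib` of `BIJ85Eq712Plancherel.thm711_of_realMomenta` for the energies.
[cite: BalabanImbrieJaffe1985, Prop. 7.1.2 (7.1.22) p.324] -/
theorem thm711_energyC (hd : 0 < d) (s : Scale) {p : Fin d → ℝ} (hp : ∀ i, |p i| ≤ π) {f : Fin d → Fin d → ℂ}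
    (hf : IsTwoForm f) {A : (Fin d → ℤ) → Fin d → ℂ} (hA : ∀ ν, qOpC s.n s.M p A ν = 0) :
    c711 d * normSq f ≤ energyC s.n s.M p A f := by
  have hn : 0 < s.n := s.pos.1
  set g : ℝ → ℝ := fun t => energyC s.n s.M (fillPath p t) (proj s.n s.M (fillPath p t) A) f with hg
  have hmaps : Set.MapsTo (fillPath p) (Set.Icc 0 π) (regC (d := d) s.n s.M) := fun t ht ν =>
    (dDiag_pos hn s.M (fillPath_abs_le hp ht.1 ht.2) ν).ne'
  have hcont : ContinuousOn g (Set.Icc 0 π) :=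
    (continuousOn_energyC_proj s.n s.M A f).comp (continuous_fillPath p).continuousOn hmaps
  have hge : ∀ t ∈ Set.Ioc (0 : ℝ) π, c711 d * normSq f ≤ g t := by
    intro t ht
    have hgen : ∀ i, fillPath p t i ≠ 0 ∧ |fillPath p t i| ≤ π := fillPath_generic hp ht.1 ht.2
    have hD : ∀ ν, dDiag s.n s.M (fillPath p t) ν ≠ 0 := fun ν => (dDiag_pos hn s.M (fun i => (hgen i).2) ν).ne'
    exact thm711_energyC_generic hd s hgen hf (qOpC_proj hD A)
  have htend : Tendsto g (𝓝[Set.Ioc 0 π] 0) (𝓝 (g 0)) :=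
    ((hcont 0 ⟨le_rfl, Real.pi_pos.le⟩).mono Set.Ioc_subset_Icc_self).tendsto
  haveI : (𝓝[Set.Ioc (0 : ℝ) π] 0).NeBot := left_nhdsWithin_Ioc_neBot Real.pi_pos
  have hlim := ge_of_tendsto htend (eventually_nhdsWithin_of_forall hge)
  rw [hg] at hlim
  dsimp only at hlim
  rwa [fillPath_zero, proj_of_constrained hA] at hlim

end

end Literature.MathematicalPhysics.QuantumFieldTheory.BalabanImbrieJaffe1984to88.BIJ85Eq7113DerivationPart5
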